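import Summits.QuantumFields.YangMills.Theorems.IR.MomentumPincerNoLightMoversSC
import Summits.QuantumFields.YangMills.Theorems.IR.SCFloorFacingPlaquette
import Summits.QuantumFields.YangMills.Theorems.IR.SCFloorSliceSums
import Literature.MathematicalPhysics.QuantumFieldTheory.OneLinkTraceShift
import Summits.QuantumFields.YangMills.Theorems.SoloBlindLatticeGapEndpoints
import Summits.QuantumFields.YangMills.Theorems.SoloBlindSmearedSpecies
import Summits.QuantumFields.YangMills.Theorems.SoloBlindSpacingPinning
import Summits.QuantumFields.YangMills.Theorems.SoloBlindOddTorusCorrelator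
import HarnessLib

/-!
# (file 1∕3: §0 objects, §1 slice identity)
# Line `momentum-pincer` (crux `IR`, stmt-QuantumFields-19354): rung R2 — the RP / transfer-matrix HALF of
# `NoLightMoversSCTransfer` — PROVED, sorry-free: `noLightMoversSCTransfer_holds` (v6: RP/TM + F0 + (F) + far field (§1–§4, this line) + the `SCFloor` engine's LANDED slice floor `sliceSum_one_floor` (§5, ym-ir-line-bsf-p1 part 19))

Route `BalabanLadder`, crux `IR`, line `momentum-pincer` (ideator ym-ir-idea-5, lens: RP transfer-matrix bounds;
skeleton `Cruxes/IR/Lines/momentum_pincer.lean` v1.6, stub `stub_noLightMoversSCTransfer : NoLightMoversSCTransfer`,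
rung R2 of `Cruxes/IR/Lines/momentum-pincer-rungs.md`).  This file isolates the ONE strong-coupling input of R2 as the
typed statement `SliceFloorSC` (a volume-uniform two-point FLOOR for the zero-momentum plaquette correlator at time
distances `0` and `1` on a compact strong-coupling window — the output of the SC floor engine `Theorems/IR/SCFloor*.lean`
of ym-ir-line-bsf-p1, whose facing-plaquette floor `SCFloor.facingPlaquetteCorr_floor` is the `x⃗ = 0` term of `s(1)`)
and PROVES everything else:

* §1 `latticeConnectedCorr_sliceSpecies` — the SLICE IDENTITY `(2S+1)³ · s_S(t) = c_{Ψ_S,Ψ_S}(t)`: the zero-momentum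
  (slice-summed) correlator `s_S(t) = sliceSumCorr ρ β S P P t` is, up to the number of spatial sites, the
  self-correlator of the SLICE SPECIES `Ψ_S = Σ_{x⃗} P(· + (0,x⃗))` (tree: bilinearity `latticeConnectedCorr_linCombSpecies`,
  translation invariance `latticeConnectedCorr_comp_configShift`, `(2S+1)ℤ⁴`-periodicity of transported observables
  `toTorusObservable_comp_configShift`, and re-indexing of the spatial torus);
* §2 hence, for a time-zero spatial `P`, `t ↦ s_S(t)` is NON-NEGATIVE and LOG-CONVEX on the odd torus (reflection
  positivity / transfer matrix: tree `latticeConnectedCorr_self_nonneg`, `latticeConnectedCorr_self_logConvex` applied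
  to `Ψ_S`), so a two-point floor `s_S(0) ≤ s_max`, `f₁ ≤ s_S(1)` propagates to the GEOMETRIC FLOOR
  `s_S(n) ≥ (f₁/s_max)^{n-1} f₁`, `1 ≤ n ≤ 2S+1` (tree `mulConvex_ratio_floor`, `mulConvex_lower_envelope`);
* §3 `noLightMoversSCTransfer_of_sliceFloorSC` — the RATE CEILING and the assembly: any valid zero-momentum clustering
  rate `m(β)` on the window obeys `m(β) ≤ L := -log (f₁/s_max)` (floor at `t = S` against the hypothesis at `t = S`,
  tree `rate_le_of_eventually_exp_le`), so with `θ := c / max(L, c)` the β-uniform strong-coupling point clustering at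
  rate `c` (R1, `noLightMoversSC_holds`) is clustering at rate `θ·m(β) ≤ c`.  The conclusion is VERBATIM the body of
  `Summit.QuantumFields.YangMills.Cruxes.IR.MomentumPincer.NoLightMoversSCTransfer` (copies of `spatialVec`,
  `sliceSumCorr` below are verbatim), so the skeleton's stub closes by
  `theorem stub_noLightMoversSCTransfer : NoLightMoversSCTransfer := noLightMoversSCTransfer_of_sliceFloorSC h`
  (definitional unfolding only) as soon as `h : SliceFloorSC` is proved by the SC engine.
* §2b `sliceSumCorr_zero_le` (F0) — the datum `s_S(0) ≤ s_max` is FREE: it holds for every species, uniformly in `S`,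
  on a window `0 ≤ β ≤ β₀`, by the β-uniform strong-coupling clustering `torusClustering_uniform_fixedRate` (R1's
  engine) and `Σ_{x⃗ ∈ 𝕋³_{2S+1}} e^{-‖x⃗‖_∞} ≤ (Σ_{k ∈ ℤ} e^{-|k|/3})³`;
* §3b hence the SMALLER inputs `SliceOneFloorSC` (only `f₁ ≤ s_S(1)`) and `SlicePowerFloorSC` (`c β^k ≤ s_S(1)` for
  `0 < β ≤ β₀`, `S ≥ S₀` — the shape the `SCFloor` engine produces, `k = 4` for a plaquette) each imply
  `NoLightMoversSCTransfer` (`noLightMoversSCTransfer_of_sliceOneFloorSC`, `noLightMoversSCTransfer_of_slicePowerFloorSC`).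
  What remains for the engine on top of its LANDED facing floor `c β⁴ ≤ Cov(P_{e₀}, P)` is the single estimate
  `|Σ_{x⃗ ≠ 0} Cov(P_{(1,x⃗)}, P)| ≤ (c/2) β⁴` for `S ≥ S₀`, `β ≤ β₀` (order-4 peeling + far-field clustering).
* §3c the CONCRETE targets over the spatial plaquette `P = Re tr ρ(U_{(0;1,2)})` (`plaquetteObs ρ 0 1 2`, the engine's
  object): `PlaquetteFacingFloorSC` (F) = the landed facing floor on odd tori (modulo its non-constant-character
  hypothesis), `PlaquetteOffDiagSliceSC` (O) = `|s_S(1) − Cov(P, P_{e₀})| ≤ C β⁵` uniformly in `S ≥ S₀` — THE remaining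
  estimate —, `sliceSumCorr_split` (`s_S = diagonal + Σ_{x⃗ ≠ 0}`), and the assembly
  `noLightMoversSCTransfer_of_facing_offdiag : PlaquetteFacingFloorSC → PlaquetteOffDiagSliceSC → NoLightMoversSCTransfer`.
* §3d (F) is PROVED (`plaquetteFacingFloorSC_holds`): the engine's LANDED `SCFloor.facingPlaquetteCorr_floor` (p606286) with
  its non-constant-character hypothesis discharged (`LatticeRep.exists_re_trace_ne`: `N − Re tr X = ½‖X − 1‖²_F` and
  faithfulness).  NET RESULT: `noLightMoversSCTransfer_of_offdiag : PlaquetteOffDiagSliceSC → NoLightMoversSCTransfer` —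
  R2 ⇐ the single volume-uniform estimate `|Σ_{x⃗ ≠ 0} Cov(P_{(0,x⃗)}, P_{e₀})| ≤ C β⁵`.
* §4 (O) SPLIT, far field PROVED: `torusClustering_uniform_activity` re-runs R1's Osterwalder–Seiler polymer bound
  KEEPING THE ACTIVITY, `|Cov(F₁, F₂∘θ_x)| ≤ K (β/r)^{‖x‖_∞ − c}` uniformly in the volume and in `0 ≤ β ≤ r`
  (R1 traded `(β/r)^n` for `e^{-n}`); `latticeConnectedCorr_shift_left` puts the slice term at `(t, x⃗)` in engine form
  with the single displacement `farVec = -t e₀ − (0,x⃗)`; `sliceSum_far_le`: `Σ_{‖x⃗‖_∞ ≥ c+k+1} |Cov(A_{(0,x⃗)}, B; t)| ≤ C β^k`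
  for ALL `S ≥ t` (geometric tail × `(Σ_{k∈ℤ} e^{-|k|/3})³`).  Hence (O) ⇐ `PlaquetteNearPairSC` (N): for each FIXED
  spatial `a ≠ 0`, `|Cov_L(P∘θ_{(0,a)}, P; 1)| ≤ C_a β⁵` for `0 < β ≤ β₀(a)`, all `L ≥ L₀(a)` — finitely many `a`
  (`‖a‖_∞ ≤ c + 5`) are used (`plaquetteOffDiagSliceSC_of_nearPair`, re-indexing `x⃗ ↦ valMinAbs ∘ x⃗` injective).
  NET RESULT (v5): `noLightMoversSCTransfer_of_nearPair : PlaquetteNearPairSC → NoLightMoversSCTransfer`.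
* §5 **R2 CLOSED** (v6): the engine's part 19 `SCFloor.sliceSum_one_floor` (LANDED, `Theorems/IR/SCFloorSliceSums.lean`:
  `κ β⁴ ≤ s_S(1)`, `0 < β ≤ β₀`, all `S ≥ 1`, under `∃ g h, Re tr ρ g ≠ Re tr ρ h`) is literally `PlaquetteSlicePowerFloorSC`
  once the character hypothesis is discharged by §3d; hence `plaquetteSlicePowerFloorSC_holds` and
  `noLightMoversSCTransfer_holds : NoLightMoversSCTransfer` — the registered stub closes BY NAME
  (`theorem stub_noLightMoversSCTransfer : NoLightMoversSCTransfer := MomentumPincerRung.noLightMoversSCTransfer_holds`,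
  kernel-tested against the verbatim skeleton decls, rc 0).  §4's (N)-route stays as the engine-light alternative.

HONEST FRAMING: strong coupling only, group-blind (simplicity of `G` is carried, not used); R2 is a RUNG exercising the
line's `p⃗ = 0 ⇒ point` transfer where the dispersion relation is computable; nothing here bears on `IR` at weak
coupling, on a continuum limit, or on the Yang–Mills mass gap (Clay); R4 of the ladder closes only the conditional
finite-𝕋⁴ rung `BalabanLadder.UV`.
Refs: K. Osterwalder, E. Seiler, Ann. Phys. 110 (1978) 440 (§2 RP / transfer matrix, Thm. 3.5 clustering);
E. Seiler, LNP 159 (1982) Ch. 2; J. Glimm, A. Jaffe, *Quantum Physics* (1987) §6.1; line card `Cruxes/IR/Lines/momentum-pincer.md`.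

Landed for item `stmt-QuantumFields-19354` (`--supports … --as helper`) by the LEAD prover ab-p1 under director-ym RULING g9-№2 ∕ №14 (3);
authored by ideator ym-ir-idea-5 g8 (line `momentum-pincer`, rung R2), MINIMAL CUT of the sorry-free workfile `Cruxes/IR/Lines/momentum_pincer_R2_transfer.lean`
v6 8c85df89ce78 (§0–§3d + §5; the by-product §4 «far field» is not landed), split in three files: `MomentumPincerR2Slice` (§0–§1) →
`MomentumPincerR2RP` (§2–§2b) → `MomentumPincerR2Closure` (§3–§3d, §5: `noLightMoversSCTransfer_holds : NoLightMoversSCTransfer`).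

-/

noncomputable section

open Filter Topology MeasureTheory Finset
open Literature.MathematicalPhysics.QuantumFieldTheory Literature.MathematicalPhysics.QuantumLattice
open Literature.Probability.LatticeModels (Torus.proj Torus.proj_apply)
open Literature.Probability.LatticeModels.Site (supNorm supNorm_le_iff natAbs_le_supNorm norm_eq_supNorm)
open Summit.QuantumFields.YangMills.Theorems.SoloBlind

namespace Summit.QuantumFields.YangMills.Cruxes.IR.MomentumPincerRung

variable {G : Type} [Group G] [TopologicalSpace G] [IsTopologicalGroup G] [CompactSpace G]
  [MeasurableSpace G] [BorelSpace G]

/-! ## §0 The line's objects (verbatim copies of `Cruxes/IR/Lines/momentum_pincer.lean` §1, which is not importable) -/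

/-- The purely spatial `ℤ⁴`-vector `(0, x⃗)` below a spatial torus site `x⃗ ∈ (ℤ/(2S+1))³` (centred representatives).
VERBATIM `Summit.QuantumFields.YangMills.Cruxes.IR.MomentumPincer.spatialVec`. -/
def spatialVec (S : ℕ) (x : Fin 3 → ZMod (2 * S + 1)) : Fin 4 → ℤ :=
  fun i => if h : i = 0 then 0 else (x (i.pred h)).valMinAbs

/-- **Zero-momentum connected time-correlation** on the torus `(2S+1)⁴` (slice sum over spatial translates of `A`
against `B` at time `t`).  VERBATIM `Summit.QuantumFields.YangMills.Cruxes.IR.MomentumPincer.sliceSumCorr`. -/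
def sliceSumCorr {N : ℕ} (ρ : G →* Matrix (Fin N) (Fin N) ℂ) (β : ℝ) (S : ℕ) (A B : LGConfig 4 G → ℝ) (t : ℕ) : ℝ :=
  ∑ x : Fin 3 → ZMod (2 * S + 1),
    latticeConnectedCorr ρ β (2 * S + 1) (fun U => A (configShift (spatialVec S x) U)) B t

/-- **R2 — `NoLightMoversSCTransfer`** (VERBATIM the body of
`Summit.QuantumFields.YangMills.Cruxes.IR.MomentumPincer.NoLightMoversSCTransfer`): on a compact strong-coupling
window `[β₁, β₀]`, zero-momentum clustering at ANY valid rate `m(β)` transfers to point clustering at rate `θ·m(β)`. -/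
def NoLightMoversSCTransfer : Prop :=
  ∀ (G : Type) [Group G] [TopologicalSpace G] [IsTopologicalGroup G] [CompactSpace G],
    IsCompactSimpleLieGroup G → letI : MeasurableSpace G := borel G; haveI : BorelSpace G := ⟨rfl⟩;
    ∀ r : LatticeRep G, ∃ β₁ β₀ θ : ℝ, 0 < β₁ ∧ β₁ < β₀ ∧ 0 < θ ∧
      ∀ (m : ℝ → ℝ) (S₁ : ℝ → ℕ), (∀ β, 0 < m β) →
        (∀ A B : YMSpecies G, ∃ C : ℝ, ∀ β : ℝ, β₁ ≤ β → β ≤ β₀ → ∀ S t : ℕ, S₁ β ≤ S → t ≤ S →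
            |sliceSumCorr r.ρ β S A.F B.F t| ≤ C * Real.exp (-(m β * t))) →
        ∃ S₃ : ℝ → ℕ, ∀ A B : YMSpecies G, ∃ C : ℝ, ∀ β : ℝ, β₁ ≤ β → β ≤ β₀ → ∀ S t : ℕ, S₃ β ≤ S → t ≤ S →
            |latticeConnectedCorr r.ρ β (2 * S + 1) A.F B.F t| ≤ C * Real.exp (-(θ * m β * t))

/-- **THE STRONG-COUPLING INPUT of R2 (`SliceFloorSC`)** — a volume-uniform TWO-POINT FLOOR for the zero-momentum
self-correlator of ONE time-zero spatial species `P` (intended: the spatial plaquette `plaquetteObservable r.ρ _ 1 2`):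
for every compact window `[β₁, β₀]` inside the strong-coupling island, on all large odd tori,
`s_S(0) ≤ s_max` (the zero-momentum susceptibility is bounded: summable clustering) and `s_S(1) ≥ f₁ > 0`
(the facing-plaquette floor `c β⁴ ≤ c_{P,P}(1)` of `SCFloor.facingPlaquetteCorr_floor` plus `O(β⁵)` control of the
off-diagonal slice terms).  No variance floor is needed (monotonicity gives `s_S(0) ≥ s_S(1)`).  The natural engine
output `∃ β₀ s_max κ > 0, ∀ β ∈ (0, β₀], ∀ S ≥ 1, s_S(0) ≤ s_max ∧ κ β⁴ ≤ s_S(1)` implies it with `f₁ := κ β₁⁴`. -/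
def SliceFloorSC : Prop :=
  ∀ (G : Type) [Group G] [TopologicalSpace G] [IsTopologicalGroup G] [CompactSpace G],
    IsCompactSimpleLieGroup G → letI : MeasurableSpace G := borel G; haveI : BorelSpace G := ⟨rfl⟩;
    ∀ r : LatticeRep G, ∃ β₀ : ℝ, 0 < β₀ ∧ ∃ P : YMSpecies G, (∀ e ∈ P.supp, e.1 0 = 0 ∧ e.2 ≠ 0) ∧
      ∀ β₁ : ℝ, 0 < β₁ → β₁ < β₀ → ∃ sMax f₁ : ℝ, ∃ S₀ : ℕ, 0 < f₁ ∧
        ∀ β : ℝ, β₁ ≤ β → β ≤ β₀ → ∀ S : ℕ, S₀ ≤ S →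
          sliceSumCorr r.ρ β S P.F P.F 0 ≤ sMax ∧ f₁ ≤ sliceSumCorr r.ρ β S P.F P.F 1

/-! ## §1 The slice identity `(2S+1)³ · s_S(t) = c_{Ψ_S,Ψ_S}(t)` -/

omit [Group G] [TopologicalSpace G] [IsTopologicalGroup G] [CompactSpace G] [BorelSpace G] in
/-- Translations compose: `θ_a (θ_b U) = θ_{a+b} U`. [folklore] -/
theorem configShift_configShift (a b : Fin 4 → ℤ) (U : LGConfig 4 G) :
    configShift a (configShift b U) = configShift (a + b) U := by
  funext e
  simp only [configShift_apply, sub_sub]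

/-- The statement's correlator sees its first argument only through the transported (torus) observable. [folklore] -/
theorem latticeConnectedCorr_congr_left {N : ℕ} (ρ : G →* Matrix (Fin N) (Fin N) ℂ) (β : ℝ) (L : ℕ) [NeZero L]
    {A A' : LGConfig 4 G → ℝ} (B : LGConfig 4 G → ℝ) (h : toTorusObservable L A = toTorusObservable L A') (n : ℕ) :
    latticeConnectedCorr ρ β L A B n = latticeConnectedCorr ρ β L A' B n := by
  have h' : ∀ U, A (torusLift L U) = A' (torusLift L U) := fun U => congrFun h U
  simp only [latticeConnectedCorr, h']

omit [Group G] [TopologicalSpace G] [IsTopologicalGroup G] [CompactSpace G] [BorelSpace G] in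
/-- `Lℤ⁴`-PERIODICITY of transported translates: `F ∘ θ_u` and `F ∘ θ_{u'}` agree on `L`-periodic configurations when
`u ≡ u' (mod L)`. [folklore] -/
theorem toTorusObservable_comp_configShift_congr {α : Type*} (L : ℕ) (F : LGConfig 4 G → α) {u u' : Fin 4 → ℤ}
    (h : Torus.proj L u = Torus.proj L u') :
    toTorusObservable L (F ∘ configShift u) = toTorusObservable L (F ∘ configShift u') := by
  rw [toTorusObservable_comp_configShift, toTorusObservable_comp_configShift, h]

/-- Differences of centred representatives represent differences: `(0, x⃗)̃ − (0, y⃗)̃ ≡ (0, x⃗ − y⃗)̃ (mod 2S+1)`. -/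
theorem proj_spatialVec_sub (S : ℕ) (x y : Fin 3 → ZMod (2 * S + 1)) :
    Torus.proj (2 * S + 1) (spatialVec S x - spatialVec S y) = Torus.proj (2 * S + 1) (spatialVec S (x - y)) := by
  funext i
  by_cases hi : i = 0
  · subst hi
    simp [Torus.proj, spatialVec]
  · simp [Torus.proj, spatialVec, hi, ZMod.coe_valMinAbs]

/-- `(0, x⃗)̃` is spatial. -/
@[simp] theorem spatialVec_zero (S : ℕ) (x : Fin 3 → ZMod (2 * S + 1)) : spatialVec S x 0 = 0 := by
  simp [spatialVec]

/-- `(0, 0⃗)̃ = 0`. -/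
@[simp] theorem spatialVec_zero_right (S : ℕ) : spatialVec S (0 : Fin 3 → ZMod (2 * S + 1)) = 0 := by
  funext i
  by_cases hi : i = 0
  · subst hi; simp [spatialVec]
  · simp [spatialVec, dif_neg hi]

/-- **The slice species** `Ψ_S := Σ_{x⃗ ∈ (ℤ/(2S+1))³} P(· + (0,x⃗)̃)` (unit weights): a gauge-invariant local observable,
time-zero spatial when `P` is. -/
def sliceSpecies (S : ℕ) (P : YMSpecies G) : YMSpecies G :=
  linCombSpecies (Finset.univ : Finset (Fin 3 → ZMod (2 * S + 1))) (fun _ => (1 : ℝ))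
    fun x => translateSpecies P (-(spatialVec S x))

omit [TopologicalSpace G] [IsTopologicalGroup G] [CompactSpace G] [BorelSpace G] in
/-- The slice species of a time-zero spatial species is time-zero spatial. -/
theorem sliceSpecies_timeZeroSpatial (S : ℕ) {P : YMSpecies G} (hP : ∀ e ∈ P.supp, e.1 0 = 0 ∧ e.2 ≠ 0) :
    ∀ e ∈ (sliceSpecies S P).supp, e.1 0 = 0 ∧ e.2 ≠ 0 :=
  isTimeZeroSpatial_linCombSpecies fun x _ =>
    isTimeZeroSpatial_translateSpecies (A := P) hP (z := -(spatialVec S x)) (by simp)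

/-- One pair term of `c_{Ψ,Ψ}`: `c_{P∘θ_{x̃}, P∘θ_{ỹ}}(t) = c_{P∘θ_{(x−y)̃}, P}(t)` (translation invariance by `ỹ`,
then periodicity `x̃ − ỹ ≡ (x − y)̃`). -/
theorem latticeConnectedCorr_pair_eq {N : ℕ} (ρ : G →* Matrix (Fin N) (Fin N) ℂ) (β : ℝ) (S : ℕ)
    (P : LGConfig 4 G → ℝ) (x y : Fin 3 → ZMod (2 * S + 1)) (t : ℕ) :
    latticeConnectedCorr ρ β (2 * S + 1) (P ∘ configShift (spatialVec S x)) (P ∘ configShift (spatialVec S y)) t =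
      latticeConnectedCorr ρ β (2 * S + 1) (fun U => P (configShift (spatialVec S (x - y)) U)) P t := by
  have hcomp : P ∘ configShift (spatialVec S x) =
      (P ∘ configShift (spatialVec S x - spatialVec S y)) ∘ configShift (spatialVec S y) := by
    funext U
    simp only [Function.comp_apply, configShift_configShift, sub_add_cancel]
  rw [hcomp, latticeConnectedCorr_comp_configShift]
  exact latticeConnectedCorr_congr_left ρ β (2 * S + 1) P
    (toTorusObservable_comp_configShift_congr (2 * S + 1) P (proj_spatialVec_sub S x y)) t

/-- **SLICE IDENTITY.**  `c_{Ψ_S,Ψ_S}(t) = (2S+1)³ · s_S(t)`: the self-correlator of the slice species is the number of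
spatial sites times the zero-momentum correlator `sliceSumCorr ρ β S P P t`. [this line's; folklore mechanism] -/
theorem latticeConnectedCorr_sliceSpecies {N : ℕ} (ρ : G →* Matrix (Fin N) (Fin N) ℂ) (hρ : Continuous ρ) (β : ℝ)
    (S : ℕ) (P : YMSpecies G) (t : ℕ) :
    latticeConnectedCorr ρ β (2 * S + 1) (sliceSpecies S P).F (sliceSpecies S P).F t =
      (Fintype.card (Fin 3 → ZMod (2 * S + 1)) : ℝ) * sliceSumCorr ρ β S P.F P.F t := by
  classical
  unfold sliceSpecies
  rw [latticeConnectedCorr_linCombSpecies ρ hρ]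
  simp only [translateSpecies_F, neg_neg, one_mul, latticeConnectedCorr_pair_eq]
  have hinner : ∀ x : Fin 3 → ZMod (2 * S + 1),
      ∑ y : Fin 3 → ZMod (2 * S + 1),
          latticeConnectedCorr ρ β (2 * S + 1) (fun U => P.F (configShift (spatialVec S (x - y)) U)) P.F t =
        sliceSumCorr ρ β S P.F P.F t := by
    intro x
    unfold sliceSumCorr
    simpa using Equiv.sum_comp (Equiv.subLeft x)
      (fun z => latticeConnectedCorr ρ β (2 * S + 1) (fun U => P.F (configShift (spatialVec S z) U)) P.F t)
  simp only [hinner, Finset.sum_const, Finset.card_univ, nsmul_eq_mul]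

end Summit.QuantumFields.YangMills.Cruxes.IR.MomentumPincerRung

end
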